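import Summits.RiemannHypothesis.RiemannHypothesis.Theses.RuelleBand
import Literature.NumberTheory.LFunctions.WeilCriterionConverse
import Literature.NumberTheory.LFunctions.WeilExplicitFormulaProofs
import HarnessLib.Audit

/-!
# Line `SketchIdeator1` (even Weil sector), stub 5: transfer to `ζ`

Route `RuelleBand`, crux `Summit.RiemannHypothesis.RiemannHypothesis.Theses.RuelleBand.ExactFirstBand`
(item stmt-RiemannHypothesis-2061), line `SketchIdeator1` (Weil positivity on the EVEN REAL sector of
test functions).  This file proves the registered stub `stub_evenTransfer` BY NAME, with the registered
signature: an implication whose five hypotheses are the statements of the line's other stubs, verbatim,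
and whose conclusion is the crux unfolded
(`∀ s, ζ s = 0 → 0 < Re s → Re s < 1 → Re s = 1/2 ∨ Im s = 0`).  The hypotheses are

1. THE ENGINE (pure analysis): an absolutely convergent exponential sum `F(x) = Σ cᵢ e^{λᵢ x}` over a
   countable index type, with `Re λᵢ ≤ R`, locally finite exponents none of which lies on the open
   positive real axis, real and `≥ -M` on `x ≥ 0`, has coefficient sum `0` on every fibre `{λᵢ = μ}`
   with `Re μ > 0`;
2. symmetric translates: for a test function `g` and real `x`, `h_x(t) = (g(t-x) + g(t+x))/2` is a
   test function, even if `g` is, real-valued if `g` is, with transform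
   `ĝ(s)(e^{(s-1/2)x} + e^{-(s-1/2)x})/2` and zero-side form `Q₀(h_x) = (Re B_g(2x) + Q₀(g))/2`, where
   `B_g = WeilConverse.expSum g` and `Q₀ = WeilConverse.zeroForm` (tree,
   `Literature/NumberTheory/LFunctions/WeilCriterionConverse.lean`);
3. for an even test function `g`: `ĝ(1-s) = ĝ(s)`, and `B_g` is even and real;
4. for every `ρ` an even real-valued test function `g` with `ĝ(ρ) ≠ 0`;
5. THE BET (RH-strength): `Re W(g ⋆ g̃) ≥ 0` (`weilQuadratic`) for every even real-valued test `g`.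

## Proof

For an even real-valued `g` one has `conj (g(-t)) = g(t)`, so `conj ĝ(s) = ĝ(1 - s̄)`
(`conj_weilMellin_of_selfAdjoint`, `WeilExplicitProofs.lean`) and the zero-side coefficient is a
square: `P_g(ρ) = ĝ(ρ) conj ĝ(1 - ρ̄) = ĝ(ρ)²` (`stub_evenTransfer_pairCoeff`).  For a test function
`h`, `Q₀(h) = W(h ⋆ h̃)`: both are the limit of the symmetric partial zero sums of `h ⋆ h̃`
(`WeilConverse.hasWeilZeroSide_zeroForm` and the PROVED explicit formula `explicit_formula_holds`),
so the bet at `h = h_{x/2}` and hypothesis 2 give the ONE-SIDED bound `Re B_g(x) ≥ -Re Q₀(g)`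
(`stub_evenTransfer_lowerBound`).  The engine, applied to `ι =` the non-trivial zeros (countable,
`WeilZeroSum.lean`), `c ρ = m(ρ) P_g(ρ)`, `λ ρ = ρ - 1/2`, `R = 1/2`, `M = Re Q₀(g)` — summable by
`WeilConverse.summable_norm_pairCoeff`, locally finite by `riemannZetaNontrivialZeros_finite_inter_ball`,
`Im λ ρ = Im ρ ≠ 0` because `ζ` has no zeros on `(0,1)` (`riemannZetaNontrivialZeros.im_ne_zero`),
`F = B_g` real by hypothesis 3 — kills `m(ρ) ĝ(ρ)²` at every non-trivial zero with `Re ρ > 1/2`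
(`stub_evenTransfer_order_mul_pairCoeff_eq_zero`); as `m(ρ) ≥ 1`, `ĝ(ρ) = 0` there, and zeros with
`Re ρ < 1/2` reflect to `1 - ρ̄` (`conj ĝ(ρ) = ĝ(1 - ρ̄)`), so `ĝ` vanishes at EVERY off-line
non-trivial zero for EVERY even real test `g` (`stub_evenTransfer_weilMellin_eq_zero`) — contradicting
hypothesis 4.  Hence a zero `s` of `ζ` with `0 < Re s < 1` (a non-trivial zero, `mem_iff'`) has
`Re s = 1/2`.

This is the even-sector version of the bookkeeping of the tree's converse Weil criterion
(`WeilConverse.order_mul_pairCoeff_eq_zero`, `WeilConverse.re_eq_one_half`; Bombieri 2000, Thm. 1,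
"if" half), with the two-sided bounded-power-sum lemma replaced by the one-sided engine.

References: E. Bombieri, *Remarks on Weil's quadratic functional in the theory of prime numbers I*,
Rend. Lincei (9) 11 (2000), 183–233, §3 Thm. 1; A. Weil, *Sur les "formules explicites" de la théorie
des nombres premiers* (1952).
-/

-- the problem directory `RiemannHypothesis/RiemannHypothesis` fixes the namespace (gate convention)
set_option linter.dupNamespace false

noncomputable section

open Complex MeasureTheory Filter Set
open scoped Real Topology ComplexConjugate

namespace Summit.RiemannHypothesis.RiemannHypothesis.Theorems.RuelleBandExactFirstBand

open Literature.NumberTheory.LFunctions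

/-- An even real-valued function is self-adjoint for the Weil involution `g̃(t) = conj g(-t)`:
`conj (g(-t)) = g(t)`. [folklore] -/
theorem stub_evenTransfer_selfAdjoint {g : ℝ → ℂ} (heven : ∀ t : ℝ, g (-t) = g t)
    (hreal : ∀ t : ℝ, (g t).im = 0) (t : ℝ) : conj (g (-t)) = g t := by
  rw [heven t]
  exact Complex.conj_eq_iff_im.2 (hreal t)

/-- For an even real-valued `g`: `conj ĝ(s) = ĝ(1 - conj s)` (`conj_weilMellin_of_selfAdjoint`;
hypothesis-free in `g` beyond evenness and realness, both sides being junk together). [folklore] -/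
theorem stub_evenTransfer_conj_weilMellin {g : ℝ → ℂ} (heven : ∀ t : ℝ, g (-t) = g t)
    (hreal : ∀ t : ℝ, (g t).im = 0) (s : ℂ) :
    conj (weilMellin g s) = weilMellin g (1 - conj s) :=
  conj_weilMellin_of_selfAdjoint (stub_evenTransfer_selfAdjoint heven hreal) s

/-- For an even real-valued `g` the zero-side coefficient is a square:
`P_g(ρ) = ĝ(ρ) conj ĝ(1 - ρ̄) = ĝ(ρ) ĝ(ρ)` (`conj ĝ(1 - ρ̄) = ĝ(1 - conj (1 - ρ̄)) = ĝ(ρ)`). [folklore] -/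
theorem stub_evenTransfer_pairCoeff {g : ℝ → ℂ} (heven : ∀ t : ℝ, g (-t) = g t)
    (hreal : ∀ t : ℝ, (g t).im = 0) (ρ : ℂ) :
    WeilConverse.pairCoeff g ρ = weilMellin g ρ * weilMellin g ρ := by
  rw [WeilConverse.pairCoeff, stub_evenTransfer_conj_weilMellin heven hreal]
  congr 2
  simp

/-- **The one-sided bound.** Under hypothesis 2 (symmetric translates) and hypothesis 5 (the bet),
for an even real-valued test function `g` and every real `x`: `-Re Q₀(g) ≤ Re B_g(x)`.  Indeed
`h = h_{x/2}` is an even real test function, so `0 ≤ Re W(h ⋆ h̃) = Re Q₀(h) = (Re B_g(x) + Re Q₀(g))/2`,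
where `Q₀(h) = W(h ⋆ h̃)` because both are the limit of the symmetric partial zero sums of `h ⋆ h̃`
(`WeilConverse.hasWeilZeroSide_zeroForm` and the PROVED explicit formula `explicit_formula_holds` at
the test function `h ⋆ h̃`; limits in `ℂ` are unique). [folklore] -/
theorem stub_evenTransfer_lowerBound
    (hT : ∀ (g : ℝ → ℂ), IsWeilTest g → ∀ x : ℝ,
      IsWeilTest (fun t : ℝ => (g (t - x) + g (t + x)) / 2) ∧
      ((∀ t : ℝ, g (-t) = g t) → ∀ t : ℝ, (g (-t - x) + g (-t + x)) / 2 = (g (t - x) + g (t + x)) / 2) ∧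
      ((∀ t : ℝ, (g t).im = 0) → ∀ t : ℝ, ((g (t - x) + g (t + x)) / 2).im = 0) ∧
      (∀ s : ℂ, weilMellin (fun t : ℝ => (g (t - x) + g (t + x)) / 2) s =
        weilMellin g s * ((cexp ((s - 1 / 2) * x) + cexp (-((s - 1 / 2) * x))) / 2)) ∧
      WeilConverse.zeroForm (fun t : ℝ => (g (t - x) + g (t + x)) / 2) =
        ((((WeilConverse.expSum g (2 * x)).re : ℝ) : ℂ) + WeilConverse.zeroForm g) / 2)
    (hB : ∀ g : ℝ → ℂ, IsWeilTest g → (∀ t : ℝ, g (-t) = g t) → (∀ t : ℝ, (g t).im = 0) →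
      0 ≤ (weilQuadratic g).re)
    {g : ℝ → ℂ} (hg : IsWeilTest g) (heven : ∀ t : ℝ, g (-t) = g t)
    (hreal : ∀ t : ℝ, (g t).im = 0) (x : ℝ) :
    -(WeilConverse.zeroForm g).re ≤ (WeilConverse.expSum g x).re := by
  obtain ⟨hh, hhev, hhre, -, hQ⟩ := hT g hg (x / 2)
  have h0 := hB _ hh (hhev heven) (hhre hreal)
  -- `Q₀(h) = W(h ⋆ h̃)` (cf. `stub_cofiniteWeilCriterion_zeroForm_eq`, crux `CofiniteCriticalLine`)
  have hQW : WeilConverse.zeroForm _ = weilQuadratic _ :=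
    tendsto_nhds_unique (WeilConverse.hasWeilZeroSide_zeroForm hh)
      (explicit_formula_holds (hh.weilConv hh.weilReflect))
  rw [← hQW, hQ, show 2 * (x / 2) = x by ring, Complex.div_ofNat_re, Complex.add_re,
    Complex.ofReal_re] at h0
  linarith

/-- **The engine applied to `B_g`.** Under hypothesis 1 (the engine), for a test function `g` whose
exponential sum `B_g` is real with `Re B_g ≥ -Re Q₀(g)` on the real line: `m(ρ₀) P_g(ρ₀) = 0` at every
non-trivial zero `ρ₀` with `Re ρ₀ > 1/2`.  Index type: the non-trivial zeros (countable); coefficients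
`c ρ = m(ρ) P_g(ρ)` (absolutely summable, `WeilConverse.summable_norm_pairCoeff`); exponents
`λ ρ = ρ - 1/2` (`Re λ ≤ 1/2`, locally finite by `riemannZetaNontrivialZeros_finite_inter_ball`, and
`Im λ ρ = Im ρ ≠ 0` since `ζ(σ) ≠ 0` on `(0,1)`, `riemannZetaNontrivialZeros.im_ne_zero`); the fibre of
`λ` over `ρ₀ - 1/2` is `{ρ₀}`. [folklore] -/
theorem stub_evenTransfer_order_mul_pairCoeff_eq_zero
    (hE : ∀ (ι : Type) [Countable ι] (c lam : ι → ℂ) (R M : ℝ),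
      Summable (fun i => ‖c i‖) → (∀ i, (lam i).re ≤ R) →
      (∀ z : ℂ, ∃ ε > 0, {i | lam i ∈ Metric.ball z ε}.Finite) →
      (∀ i, 0 < (lam i).re → (lam i).im ≠ 0) →
      (∀ x : ℝ, 0 ≤ x → (∑' i, c i * cexp (lam i * x)).im = 0) →
      (∀ x : ℝ, 0 ≤ x → -M ≤ (∑' i, c i * cexp (lam i * x)).re) →
      ∀ μ : ℂ, 0 < μ.re → ∀ s : Finset ι, (∀ i, i ∈ s ↔ lam i = μ) → ∑ i ∈ s, c i = 0)
    {g : ℝ → ℂ} (hg : IsWeilTest g) (hBreal : ∀ x : ℝ, (WeilConverse.expSum g x).im = 0)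
    (hbound : ∀ x : ℝ, -(WeilConverse.zeroForm g).re ≤ (WeilConverse.expSum g x).re)
    {ρ₀ : ℂ} (hρ₀ : ρ₀ ∈ ZetaZeros.riemannZetaNontrivialZeros) (hre : 1 / 2 < ρ₀.re) :
    (riemannZetaZeroOrder ρ₀ : ℂ) * WeilConverse.pairCoeff g ρ₀ = 0 := by
  -- adapted from `WeilConverse.order_mul_pairCoeff_eq_zero` (Literature/…/WeilCriterionConverse.lean)
  have h := hE ZetaZeros.riemannZetaNontrivialZeros
    (fun ρ : ZetaZeros.riemannZetaNontrivialZeros ↦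
      (riemannZetaZeroOrder (ρ : ℂ) : ℂ) * WeilConverse.pairCoeff g ρ)
    (fun ρ : ZetaZeros.riemannZetaNontrivialZeros ↦ (ρ : ℂ) - 1 / 2) (1 / 2)
    (WeilConverse.zeroForm g).re (WeilConverse.summable_norm_pairCoeff hg)
    (fun ρ ↦ (le_abs_self _).trans (WeilConverse.abs_re_sub_half_le ρ.2)) (fun z ↦ ?_)
    (fun ρ _ ↦ by
      simpa [Complex.sub_im] using ZetaZeros.riemannZetaNontrivialZeros.im_ne_zero ρ.2)
    (fun x _ ↦ hBreal x) (fun x _ ↦ hbound x) (ρ₀ - 1 / 2)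
    (by simp only [Complex.sub_re, Complex.div_ofNat_re, Complex.one_re]; linarith)
    {⟨ρ₀, hρ₀⟩} (fun ρ ↦ ?_)
  · simpa using h
  · -- local finiteness of the exponents `ρ - 1/2`
    refine ⟨1, one_pos, ?_⟩
    refine ((riemannZetaNontrivialZeros_finite_inter_ball (z + 1 / 2) 1).preimage
      (Subtype.val_injective.injOn)).subset fun ρ hρ ↦ ?_
    simp only [mem_setOf_eq, Metric.mem_ball, dist_eq_norm] at hρ
    refine ⟨ρ.2, ?_⟩
    rw [Metric.mem_ball, dist_eq_norm]
    rwa [show (ρ : ℂ) - (z + 1 / 2) = (ρ : ℂ) - 1 / 2 - z by ring]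
  · -- the fibre over `ρ₀ - 1/2` is `{ρ₀}`
    rw [Finset.mem_singleton, sub_left_inj]
    constructor
    · rintro rfl; rfl
    · intro h; exact Subtype.ext h

/-- **`ĝ` vanishes at every off-line non-trivial zero, for every even real test `g`** (under the
engine, with `B_g` real and `Re B_g ≥ -Re Q₀(g)`).  For `Re ρ > 1/2`: `m(ρ) P_g(ρ) = 0`
(`stub_evenTransfer_order_mul_pairCoeff_eq_zero`) with `m(ρ) ≥ 1` and `P_g(ρ) = ĝ(ρ)²`; for
`Re ρ < 1/2`: `1 - ρ̄` is a non-trivial zero with `Re > 1/2`, and `conj ĝ(ρ) = ĝ(1 - ρ̄) = 0`.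
[folklore] -/
theorem stub_evenTransfer_weilMellin_eq_zero
    (hE : ∀ (ι : Type) [Countable ι] (c lam : ι → ℂ) (R M : ℝ),
      Summable (fun i => ‖c i‖) → (∀ i, (lam i).re ≤ R) →
      (∀ z : ℂ, ∃ ε > 0, {i | lam i ∈ Metric.ball z ε}.Finite) →
      (∀ i, 0 < (lam i).re → (lam i).im ≠ 0) →
      (∀ x : ℝ, 0 ≤ x → (∑' i, c i * cexp (lam i * x)).im = 0) →
      (∀ x : ℝ, 0 ≤ x → -M ≤ (∑' i, c i * cexp (lam i * x)).re) →
      ∀ μ : ℂ, 0 < μ.re → ∀ s : Finset ι, (∀ i, i ∈ s ↔ lam i = μ) → ∑ i ∈ s, c i = 0)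
    {g : ℝ → ℂ} (hg : IsWeilTest g) (heven : ∀ t : ℝ, g (-t) = g t)
    (hreal : ∀ t : ℝ, (g t).im = 0) (hBreal : ∀ x : ℝ, (WeilConverse.expSum g x).im = 0)
    (hbound : ∀ x : ℝ, -(WeilConverse.zeroForm g).re ≤ (WeilConverse.expSum g x).re)
    {ρ : ℂ} (hρ : ρ ∈ ZetaZeros.riemannZetaNontrivialZeros) (hre : ρ.re ≠ 1 / 2) :
    weilMellin g ρ = 0 := by
  -- zeros to the right of the critical line
  have key : ∀ ρ : ℂ, ρ ∈ ZetaZeros.riemannZetaNontrivialZeros → 1 / 2 < ρ.re →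
      weilMellin g ρ = 0 := by
    intro ρ hρ hgt
    have h := stub_evenTransfer_order_mul_pairCoeff_eq_zero hE hg hBreal hbound hρ hgt
    have hm : (riemannZetaZeroOrder ρ : ℂ) ≠ 0 := by
      have := ZetaZeros.riemannZetaNontrivialZeros.one_le_order hρ
      exact_mod_cast (by omega : riemannZetaZeroOrder ρ ≠ 0)
    rw [stub_evenTransfer_pairCoeff heven hreal, mul_eq_zero, or_iff_right hm] at h
    exact mul_self_eq_zero.1 h
  rcases hre.lt_or_gt with hlt | hgt
  · -- zeros to the left reflect to the right: `conj ĝ(ρ) = ĝ(1 - ρ̄) = 0`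
    have h1 := key (1 - conj ρ) (ZetaZeros.riemannZetaNontrivialZeros.one_sub_conj_mem hρ)
      (by rw [WeilConverse.one_sub_conj_re]; linarith)
    rwa [← stub_evenTransfer_conj_weilMellin heven hreal, map_eq_zero] at h1
  · exact key ρ hρ hgt

/-- **Stub 5 of line `SketchIdeator1` — transfer to `ζ` (registered signature).**  Engine
(hypothesis 1) + symmetric translates (hypothesis 2) + realness of `B_g` for even `g` (hypothesis 3) +
even real test functions seen by a given point (hypothesis 4) + THE BET, Weil positivity on the even
real sector (hypothesis 5) ⟹ every zero of `ζ` in the open critical strip lies on the critical line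
(or on the real axis).  Given a zero `s` with `0 < Re s < 1` (a non-trivial zero, `mem_iff'`) and
`Re s ≠ 1/2`, hypothesis 4 supplies an even real test `g` with `ĝ(s) ≠ 0`, contradicting
`stub_evenTransfer_weilMellin_eq_zero` (fed by `stub_evenTransfer_lowerBound` and hypothesis 3). -/
theorem stub_evenTransfer :
    (∀ (ι : Type) [Countable ι] (c lam : ι → ℂ) (R M : ℝ),
      Summable (fun i => ‖c i‖) → (∀ i, (lam i).re ≤ R) →
      (∀ z : ℂ, ∃ ε > 0, {i | lam i ∈ Metric.ball z ε}.Finite) →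
      (∀ i, 0 < (lam i).re → (lam i).im ≠ 0) →
      (∀ x : ℝ, 0 ≤ x → (∑' i, c i * cexp (lam i * x)).im = 0) →
      (∀ x : ℝ, 0 ≤ x → -M ≤ (∑' i, c i * cexp (lam i * x)).re) →
      ∀ μ : ℂ, 0 < μ.re → ∀ s : Finset ι, (∀ i, i ∈ s ↔ lam i = μ) → ∑ i ∈ s, c i = 0) →
    (∀ (g : ℝ → ℂ), IsWeilTest g → ∀ x : ℝ,
      IsWeilTest (fun t : ℝ => (g (t - x) + g (t + x)) / 2) ∧
      ((∀ t : ℝ, g (-t) = g t) → ∀ t : ℝ, (g (-t - x) + g (-t + x)) / 2 = (g (t - x) + g (t + x)) / 2) ∧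
      ((∀ t : ℝ, (g t).im = 0) → ∀ t : ℝ, ((g (t - x) + g (t + x)) / 2).im = 0) ∧
      (∀ s : ℂ, weilMellin (fun t : ℝ => (g (t - x) + g (t + x)) / 2) s =
        weilMellin g s * ((cexp ((s - 1 / 2) * x) + cexp (-((s - 1 / 2) * x))) / 2)) ∧
      WeilConverse.zeroForm (fun t : ℝ => (g (t - x) + g (t + x)) / 2) =
        ((((WeilConverse.expSum g (2 * x)).re : ℝ) : ℂ) + WeilConverse.zeroForm g) / 2) →
    (∀ (g : ℝ → ℂ), IsWeilTest g → (∀ t : ℝ, g (-t) = g t) →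
      (∀ s : ℂ, weilMellin g (1 - s) = weilMellin g s) ∧
      ∀ y : ℝ, WeilConverse.expSum g (-y) = WeilConverse.expSum g y ∧ (WeilConverse.expSum g y).im = 0) →
    (∀ ρ : ℂ, ∃ g : ℝ → ℂ, IsWeilTest g ∧ (∀ t : ℝ, g (-t) = g t) ∧ (∀ t : ℝ, (g t).im = 0) ∧
      weilMellin g ρ ≠ 0) →
    (∀ g : ℝ → ℂ, IsWeilTest g → (∀ t : ℝ, g (-t) = g t) → (∀ t : ℝ, (g t).im = 0) →
      0 ≤ (weilQuadratic g).re) →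
    ∀ s : ℂ, riemannZeta s = 0 → 0 < s.re → s.re < 1 → s.re = 1 / 2 ∨ s.im = 0 := by
  intro hE hT hX hW hB s hs h0 h1
  have hmem : s ∈ ZetaZeros.riemannZetaNontrivialZeros :=
    ZetaZeros.riemannZetaNontrivialZeros.mem_iff'.2 ⟨hs, h0, h1⟩
  refine Or.inl ?_
  by_contra hne
  obtain ⟨g, hg, heven, hreal, hg0⟩ := hW s
  exact hg0 (stub_evenTransfer_weilMellin_eq_zero hE hg heven hreal
    (fun x ↦ ((hX g hg heven).2 x).2) (stub_evenTransfer_lowerBound hT hB hg heven hreal) hmem hne)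

end Summit.RiemannHypothesis.RiemannHypothesis.Theorems.RuelleBandExactFirstBand

end
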